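import Literature.Dynamics.SymbolicDynamics.DistortionGlueGap
import HarnessLib

/-!
# Gluing two completed boxes at level: the sheared configuration

The `↓`-layer of the gluing construction for the distortion subshift in the remaining case of
Gangloff–Sablik Prop. 32 — the second block roughly LEVEL with the first and far to its right.
Start from the gap configuration with the second box far BELOW (`gapSetB`: completed box of
`N₁`, `k` lines under it, completed box of `N₂` translated by `u' = (u.1, u.2 - H)`), in which
every chain is level in the columns strictly between the two boxes, and **shear** it
(`DistortionSkeleton.lean`, `IsDeltaSet.shear`) along the window of columns `⟦E+1, E+1+H⟧`:
everything right of the window is raised by `H`, so the second box lands at offset `u`, and the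
chains climb the window diagonally (`levSet`). The curve through `(0, ρ₁)` crosses, in the window,
ALL the chains below it — the rays of the first box below it, the `k` lines, and all the west rays
of the second box (this uses the refined crossing lemma `succPerm_pow_window'`: the `k ≥ K₀` lines
bring the curve down to the level of those rays in time) — so it passes under the second box, and
again the two curves differ by an index `V₀ + k` (`level_main`).

## References

* S. Gangloff, M. Sablik, *Quantified block gluing for multidimensional subshifts of finite type:
  aperiodicity and entropy*, J. Anal. Math. 144 (2021), §5.4.2, proof of Prop. 32 ("the curve
  is shifted downwards … in a straight way", arXiv:1706.01627).
-/

namespace Literature.Dynamics.SymbolicDynamics.Distortion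

/-! ### The gap configuration with the second box below -/

/-- Completed box of `N₁`, `k` lines BELOW it (rows `Bo - L - 3 - 2j`), completed box of `N₂`
translated by `u` (far below). [cite: GangloffSablik2021, §5.4.2 (arXiv numbering), proof of Prop. 32] -/
def gapSetB (N₁ N₂ : Set (ℤ × ℤ)) (W E Bo T : ℤ) (u : ℤ × ℤ) (k : ℕ) : Set (ℤ × ℤ) :=
  (boxCompl N₁ W E Bo T ∪ lines (Bo - (E - W) - 1 - 2 * k) k) ∪ shiftSet u (boxCompl N₂ W E Bo T)

section GapB

variable {N₁ N₂ : Set (ℤ × ℤ)} {W E Bo T : ℤ} {u : ℤ × ℤ} {K : ℕ}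
  (hN₁ : IsDeltaSet N₁) (hN₂ : IsDeltaSet N₂) (hWE : W ≤ E) (hBT : Bo ≤ T)
  (hu : u.2 ≤ Bo - T - 2 * (E - W) - 4 - 2 * K)

/-- [folklore] -/
theorem mem_gapSetB_mk {k : ℕ} {i j : ℤ} : (i, j) ∈ gapSetB N₁ N₂ W E Bo T u k ↔
    (i, j) ∈ boxCompl N₁ W E Bo T ∨ (i, j) ∈ lines (Bo - (E - W) - 1 - 2 * k) k ∨
      (i - u.1, j - u.2) ∈ boxCompl N₂ W E Bo T := by
  simp only [gapSetB, Set.mem_union, mem_shiftSet_mk, or_assoc]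

include hWE hBT hu in
/-- Upper zone: only the first box's completion. [cite: GangloffSablik2021, §5.4.2 (arXiv numbering)] -/
theorem mem_gapSetB_z1 {k : ℕ} (hk : k ≤ K) {i j : ℤ} (hj : Bo - (E - W) - 2 ≤ j) :
    (i, j) ∈ gapSetB N₁ N₂ W E Bo T u k ↔ (i, j) ∈ boxCompl N₁ W E Bo T := by
  rw [mem_gapSetB_mk]
  constructor
  · rintro (h | h | h)
    · exact h
    · have := lines_row_bounds h; simp only at this; omega
    · have := boxCompl_row_bounds hWE hBT h; omega
  · exact fun h => Or.inl h

include hWE hBT in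
/-- Middle zone: only the lines. [cite: GangloffSablik2021, §5.4.2 (arXiv numbering)] -/
theorem mem_gapSetB_z2 {k : ℕ} {i j : ℤ} (hj1 : u.2 + T + (E - W) + 1 < j) (hj2 : j < Bo - (E - W) - 1) :
    (i, j) ∈ gapSetB N₁ N₂ W E Bo T u k ↔ ∃ l : ℕ, l < k ∧ j = Bo - (E - W) - 1 - 2 * k + 2 * l := by
  rw [mem_gapSetB_mk]
  constructor
  · rintro (h | h | h)
    · have := boxCompl_row_bounds hWE hBT h; omega
    · exact h
    · have := boxCompl_row_bounds hWE hBT h; omega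
  · exact fun h => Or.inr (Or.inl h)

include hWE hBT in
/-- Lower zone: only the second box's completion. [cite: GangloffSablik2021, §5.4.2 (arXiv numbering)] -/
theorem mem_gapSetB_z3 {k : ℕ} (hk : k ≤ K) {i j : ℤ} (hj : j ≤ Bo - (E - W) - 2 - 2 * K) :
    (i, j) ∈ gapSetB N₁ N₂ W E Bo T u k ↔ (i - u.1, j - u.2) ∈ boxCompl N₂ W E Bo T := by
  rw [mem_gapSetB_mk]
  constructor
  · rintro (h | h | h)
    · have := boxCompl_row_bounds hWE hBT h; omega
    · have := lines_row_bounds h; simp only at this; omega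
    · exact h
  · exact fun h => Or.inr (Or.inr h)

include hN₁ hN₂ hWE hBT hu in
/-- **The gap-below configuration obeys the rules.** [cite: GangloffSablik2021, §5.4.2 (arXiv numbering), proof of Prop. 32] -/
theorem isDeltaSet_gapSetB {k : ℕ} (hk : k ≤ K) : IsDeltaSet (gapSetB N₁ N₂ W E Bo T u k) := by
  apply IsDeltaSet.union (IsDeltaSet.union (hN₁.boxCompl hWE hBT) (isDeltaSet_lines _ _) ?_ ?_)
    ((hN₂.boxCompl hWE hBT).shiftSet u)
  · rintro i j (h | h) h'
    · have h1 := boxCompl_row_bounds hWE hBT h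
      have h2 := boxCompl_row_bounds hWE hBT (mem_shiftSet_mk.mp h')
      omega
    · have h1 := lines_row_bounds h
      have h2 := boxCompl_row_bounds hWE hBT (mem_shiftSet_mk.mp h')
      simp only at h1; omega
  · rintro i j h (h' | h')
    · have h1 := boxCompl_row_bounds hWE hBT (mem_shiftSet_mk.mp h)
      have h2 := boxCompl_row_bounds hWE hBT h'
      omega
    · have h1 := boxCompl_row_bounds hWE hBT (mem_shiftSet_mk.mp h)
      have h2 := lines_row_bounds h'
      simp only at h2; omega
  · intro i j h h'
    have h1 := boxCompl_row_bounds hWE hBT h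
    have h2 := lines_row_bounds h'
    simp only at h2; omega
  · intro i j h h'
    have h1 := lines_row_bounds h
    have h2 := boxCompl_row_bounds hWE hBT h'
    simp only at h1; omega

include hWE in
/-- Between the two boxes every chain of the gap-below configuration is level: membership only
depends on the row. [cite: GangloffSablik2021, §5.4.2 (arXiv numbering)] -/
theorem mem_gapSetB_between {k : ℕ} {t j : ℤ} (ht1 : E < t) (ht2 : t < u.1 + W) :
    (t, j) ∈ gapSetB N₁ N₂ W E Bo T u k ↔ (E + 1, j) ∈ gapSetB N₁ N₂ W E Bo T u k := by
  rw [mem_gapSetB_mk, mem_gapSetB_mk, mem_boxCompl_of_gt hWE (i := t) (j := j) ht1,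
    mem_boxCompl_of_gt hWE (i := E + 1) (j := j) (by omega),
    mem_boxCompl_of_lt hWE (i := t - u.1) (j := j - u.2) (by omega),
    mem_boxCompl_of_lt hWE (i := E + 1 - u.1) (j := j - u.2) (by omega)]
  simp only [mem_lines]

/-! ### The sheared configuration -/

/-- **The level configuration**: the gap-below configuration for the offset `(u.1, u.2 - H)`,
sheared by `H` along the window of columns `⟦E+1, E+1+H⟧`.
[cite: GangloffSablik2021, §5.4.2 (arXiv numbering), proof of Prop. 32] -/
def levSet (N₁ N₂ : Set (ℤ × ℤ)) (W E Bo T : ℤ) (u : ℤ × ℤ) (H k : ℕ) : Set (ℤ × ℤ) :=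
  shear (E + 1) H (gapSetB N₁ N₂ W E Bo T (u.1, u.2 - H) k)

include hN₁ hN₂ hWE hBT in
/-- **The level configuration obeys the rules.** [cite: GangloffSablik2021, §5.4.2 (arXiv numbering), proof of Prop. 32] -/
theorem isDeltaSet_levSet {H k : ℕ} (hk : k ≤ K) (hu' : u.2 - H ≤ Bo - T - 2 * (E - W) - 4 - 2 * K)
    (hwin : E + 1 + H < u.1 + W) : IsDeltaSet (levSet N₁ N₂ W E Bo T u H k) := by
  refine (isDeltaSet_gapSetB hN₁ hN₂ hWE hBT (u := (u.1, u.2 - H)) hu' hk).shear (E + 1) H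
    fun t j ht1 ht2 => ?_
  rw [mem_gapSetB_between hWE (t := t) (j := j) (by omega) (by simp only; omega),
    mem_gapSetB_between hWE (t := t + 1) (j := j) (by omega) (by simp only; omega)]

include hWE hBT in
/-- On the first box the level configuration is `N₁`. [cite: GangloffSablik2021, §5.4.2 (arXiv numbering)] -/
theorem mem_levSet_box₁ {H k : ℕ} (hk : k ≤ K) (hu' : u.2 - H ≤ Bo - T - 2 * (E - W) - 4 - 2 * K)
    {i j : ℤ} (h1 : W ≤ i) (h2 : i ≤ E) (h3 : Bo ≤ j) (h4 : j ≤ T) :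
    (i, j) ∈ levSet N₁ N₂ W E Bo T u H k ↔ (i, j) ∈ N₁ := by
  show (i, j - shearHt (E + 1) H i) ∈ gapSetB N₁ N₂ W E Bo T (u.1, u.2 - H) k ↔ _
  rw [shearHt_of_le (show i ≤ E + 1 by omega), sub_zero,
    mem_gapSetB_z1 hWE hBT (u := (u.1, u.2 - H)) hu' hk (by omega), mem_boxCompl_box h1 h2 h3 h4]

include hWE hBT in
/-- On the translated second box it is `u + N₂`. [cite: GangloffSablik2021, §5.4.2 (arXiv numbering)] -/
theorem mem_levSet_box₂ {H k : ℕ} (hk : k ≤ K) (hu' : u.2 - H ≤ Bo - T - 2 * (E - W) - 4 - 2 * K)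
    (hwin : E + 1 + H < u.1 + W) {i j : ℤ} (h1 : W ≤ i - u.1) (h2 : i - u.1 ≤ E) (h3 : Bo ≤ j - u.2)
    (h4 : j - u.2 ≤ T) : (i, j) ∈ levSet N₁ N₂ W E Bo T u H k ↔ (i - u.1, j - u.2) ∈ N₂ := by
  show (i, j - shearHt (E + 1) H i) ∈ gapSetB N₁ N₂ W E Bo T (u.1, u.2 - H) k ↔ _
  rw [shearHt_of_ge (show E + 1 + (H : ℤ) ≤ i by omega),
    mem_gapSetB_z3 hWE hBT (u := (u.1, u.2 - H)) hk (by omega)]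
  simp only
  rw [show j - (H : ℤ) - (u.2 - H) = j - u.2 by ring, mem_boxCompl_box h1 h2 h3 h4]

end GapB

/-! ### The index offset in the level configuration -/

section LevelMain

variable {N₁ N₂ : Set (ℤ × ℤ)} {W E Bo T : ℤ} {u : ℤ × ℤ} {K H : ℕ} {ρ₁ ρ₂ : ℤ}
  (hN₁ : IsDeltaSet N₁) (hN₂ : IsDeltaSet N₂) (hW : W ≤ 0) (hE : 0 ≤ E) (hBT : Bo ≤ T)
  (hu' : u.2 - H ≤ Bo - T - 2 * (E - W) - 4 - 2 * K) (hwin : E + 1 + H < u.1 + W)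
  (hH1 : T - Bo + (E - W) + 2 + 2 * K ≤ H)
  (hρ₁ : Bo ≤ ρ₁) (hρ₁' : ρ₁ ≤ T) (hρ₂ : Bo ≤ ρ₂) (hρ₂' : ρ₂ ≤ T)

/-- Rows of the gap-below configuration. [folklore] -/
theorem gapSetB_row_bounds (hWE : W ≤ E) (hBT : Bo ≤ T) {u' : ℤ × ℤ} {k : ℕ}
    (hu2 : u'.2 ≤ 0) {i j : ℤ} (h : (i, j) ∈ gapSetB N₁ N₂ W E Bo T u' k) :
    u'.2 + Bo - 1 - (E - W) - 2 * k ≤ j ∧ j ≤ T + 1 + (E - W) := by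
  rcases mem_gapSetB_mk.mp h with h | h | h
  · have := boxCompl_row_bounds hWE hBT h; constructor <;> omega
  · have := lines_row_bounds h; simp only at this; constructor <;> omega
  · have := boxCompl_row_bounds hWE hBT h; constructor <;> omega

include hN₁ hN₂ hW hE hBT hu' hwin hH1 hρ₁ hρ₁' hρ₂ hρ₂' in
/-- **The index offset in the level configuration.** For `K₀ ≤ k ≤ K` lines (with
`K₀ = T - Bo + L + 2 - u.2`), in the skeleton of `levSet … u H k` the cells `c₁ = (0, ρ₁)` and
`c₂ = u + (0, ρ₂)` satisfy `c₂ = succ^{u.1} (nxt^{V₀ + k} (c₁))` with `V₀` independent of `k`.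
[cite: GangloffSablik2021, §5.4.2 (arXiv numbering), proof of Prop. 32] -/
theorem level_main (hn₁ : ((0 : ℤ), ρ₁) ∉ N₁) (hn₂ : ((0 : ℤ), ρ₂) ∉ N₂) : ∃ V₀ : ℤ, ∀ k : ℕ, k ≤ K →
    T - Bo + (E - W) + 2 - u.2 ≤ k →
    ∀ (hz : IsDelta (skel (levSet N₁ N₂ W E Bo T u H k)))
      (h₁ : skel (levSet N₁ N₂ W E Bo T u H k) (0, ρ₁) ≠ none)
      (h₂ : skel (levSet N₁ N₂ W E Bo T u H k) (u.1, u.2 + ρ₂) ≠ none),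
      (succPerm hz ^ u.1) ((nxtPerm hz ^ (V₀ + k)) ⟨(0, ρ₁), h₁⟩) = ⟨(u.1, u.2 + ρ₂), h₂⟩ := by
  have hWE : W ≤ E := by omega
  -- reference configurations: the two completed boxes alone
  set R₁ := skel (boxCompl N₁ W E Bo T) with hR₁_def
  have hR₁ : IsDelta R₁ := isDelta_skel_iff.mpr (hN₁.boxCompl hWE hBT)
  set R₂ := skel (shiftSet u (boxCompl N₂ W E Bo T)) with hR₂_def
  have hR₂ : IsDelta R₂ := isDelta_skel_iff.mpr ((hN₂.boxCompl hWE hBT).shiftSet u)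
  set R₃ := skel (shiftSet (u.1, u.2 - H) (boxCompl N₂ W E Bo T)) with hR₃_def
  have hc₁R : R₁ (0, ρ₁) ≠ none := fun h =>
    hn₁ ((mem_boxCompl_box hW hE hρ₁ hρ₁').mp (skel_eq_none_iff.mp h))
  have hc₂R : R₂ (u.1, u.2 + ρ₂) ≠ none := by
    intro h
    have := mem_shiftSet_mk.mp (skel_eq_none_iff.mp h)
    rw [mem_boxCompl_box (by omega) (by omega) (by omega) (by omega)] at this
    exact hn₂ (by simpa using this)
  set c₁R : RC R₁ := ⟨(0, ρ₁), hc₁R⟩ with hc₁R_def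
  set c₂R : RC R₂ := ⟨(u.1, u.2 + ρ₂), hc₂R⟩ with hc₂R_def
  obtain ⟨m₁, hm₁⟩ : ∃ m₁ : ℕ, (m₁ : ℤ) = E + 1 := ⟨(E + 1).toNat, by omega⟩
  obtain ⟨s₃, hs₃⟩ : ∃ s₃ : ℕ, (s₃ : ℤ) = u.1 + 1 - H := ⟨(u.1 + 1 - H).toNat, by omega⟩
  set t₀ := u.1 + E + 2 with ht₀_def
  obtain ⟨e₁, he₁⟩ : ∃ e₁ : ℤ, ((succPerm hR₁ ^ m₁) c₁R).1 = (E + 1, e₁) :=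
    ⟨_, Prod.ext (by rw [(succPerm_pow_row_bounds hR₁ c₁R m₁).1, hm₁]; simp [hc₁R_def]) rfl⟩
  have he₁b : ρ₁ - (E + 1) ≤ e₁ ∧ e₁ ≤ ρ₁ := by
    have h := succPerm_pow_row_bounds hR₁ c₁R m₁
    rw [he₁] at h; simp only [hc₁R_def] at h; constructor <;> omega
  obtain ⟨f₂, hf₂⟩ : ∃ f₂ : ℤ, ((succPerm hR₂ ^ m₁) c₂R).1 = (u.1 + E + 1, f₂) :=
    ⟨_, Prod.ext (by rw [(succPerm_pow_row_bounds hR₂ c₂R m₁).1, hm₁]; simp [hc₂R_def]; ring) rfl⟩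
  have hf₂b : u.2 + ρ₂ - (E + 1) ≤ f₂ ∧ f₂ ≤ u.2 + ρ₂ := by
    have h := succPerm_pow_row_bounds hR₂ c₂R m₁
    rw [hf₂] at h; simp only [hc₂R_def] at h; constructor <;> omega
  -- the `k`-independent counts
  set lo' := u.2 - H + Bo - (E - W) - 2 * K - 3 with hlo'_def
  set S₁ := u.2 - H + T + (E - W) + 2 with hS₁_def
  set S₂ := Bo - (E - W) - 2 with hS₂_def
  set M₂ := u.2 + Bo - (E - W) - 2 with hM₂_def
  set q := noneCount R₃ (E + 1) lo' S₁ with hq_def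
  set C₁ := noneCount R₁ (E + 1) S₂ e₁ with hC₁_def
  set B := noneCount R₂ t₀ M₂ f₂ with hB_def
  refine ⟨f₂ - e₁ + C₁ + q - B, fun k hk hk0 hz h₁ h₂ => ?_⟩
  -- membership in the level configuration, by columns
  set zk := skel (levSet N₁ N₂ W E Bo T u H k) with hzk_def
  have hmem : ∀ i j : ℤ, zk (i, j) = none ↔
      (i, j - shearHt (E + 1) H i) ∈ gapSetB N₁ N₂ W E Bo T (u.1, u.2 - H) k := fun i j => by
    rw [hzk_def, skel_eq_none_iff]; rfl
  have hmemL : ∀ i j : ℤ, i ≤ E + 1 → (zk (i, j) = none ↔ (i, j) ∈ gapSetB N₁ N₂ W E Bo T (u.1, u.2 - H) k) := by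
    intro i j hi; rw [hmem, shearHt_of_le hi, sub_zero]
  have hmemR : ∀ i j : ℤ, E + 1 + H ≤ i →
      (zk (i, j) = none ↔ (i, j - H) ∈ gapSetB N₁ N₂ W E Bo T (u.1, u.2 - H) k) := by
    intro i j hi; rw [hmem, shearHt_of_ge hi]
  have hmemW : ∀ (s : ℕ) (j : ℤ), s ≤ H →
      (zk (E + 1 + s, j) = none ↔ (E + 1, j - s) ∈ gapSetB N₁ N₂ W E Bo T (u.1, u.2 - H) k) := by
    intro s j hs
    rw [hmem, shearHt_of_mem (by omega) (by omega), show E + 1 + (s : ℤ) - (E + 1) = s by ring,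
      mem_gapSetB_between hWE (t := E + 1 + s) (j := j - s) (by omega) (by simp only; omega)]
  set c₁ : RC zk := ⟨(0, ρ₁), h₁⟩ with hc₁_def
  set c₂ : RC zk := ⟨(u.1, u.2 + ρ₂), h₂⟩ with hc₂_def
  -- (1) first curve to column `E + 1`
  have hp₁ : ((succPerm hz ^ m₁) c₁).1 = (E + 1, e₁) := by
    rw [← he₁]
    refine succPerm_pow_local hR₁ hz c₁R c₁ rfl m₁ (fun t j _ h2 h3 _ => ?_) m₁ le_rfl
    simp only [hc₁R_def] at h2 h3
    rw [hR₁_def, skel_eq_none_iff, hmemL t j (by omega), mem_gapSetB_z1 hWE hBT hu' hk (by omega)]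
  set p₁ := (succPerm hz ^ m₁) c₁ with hp₁_def
  -- (2) the window: rows of the chains at column `E + 1` before the shear
  classical
  set F : Finset ℤ := (Finset.Icc lo' (T + 1 + (E - W))).filter fun r =>
    (E + 1, r) ∈ gapSetB N₁ N₂ W E Bo T (u.1, u.2 - H) k with hF_def
  have hFmem : ∀ r : ℤ, r ∈ F ↔ (E + 1, r) ∈ gapSetB N₁ N₂ W E Bo T (u.1, u.2 - H) k := by
    intro r
    rw [hF_def, Finset.mem_filter, Finset.mem_Icc]
    constructor
    · exact fun h => h.2
    · intro h
      have := gapSetB_row_bounds hWE hBT (u' := (u.1, u.2 - H)) (by simp only; omega) h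
      simp only at this
      exact ⟨⟨by omega, by omega⟩, h⟩
  have hwinF : ∀ (s : ℕ) (j : ℤ), s ≤ H → (zk (p₁.1.1 + s, j) = none ↔ j - s ∈ F) := by
    intro s j hs
    rw [hp₁, hmemW s j hs, hFmem]
  -- the lines are in `F`, between the second box's rays and the first curve
  have hlinesF : ∀ l : ℕ, l < k → Bo - (E - W) - 1 - 2 * k + 2 * l ∈ F := by
    intro l hl
    rw [hFmem, mem_gapSetB_mk]
    exact Or.inr (Or.inl ⟨l, hl, rfl⟩)
  have hdense : ∀ r ∈ F, r < p₁.1.2 →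
      p₁.1.2 - r ≤ H + ((F.filter fun r' => r < r' ∧ r' < p₁.1.2).card : ℕ) := by
    intro r hr hrlt
    rw [hp₁] at hrlt ⊢
    simp only at hrlt ⊢
    rcases mem_gapSetB_mk.mp ((hFmem r).mp hr) with h | h | h
    · have := boxCompl_row_bounds hWE hBT h
      omega
    · have := lines_row_bounds h
      simp only at this
      omega
    · -- a west ray of the second box: the `k` lines lie strictly between it and the curve
      have hb := boxCompl_row_bounds hWE hBT h
      simp only at hb
      have hsub : (Finset.range k).image (fun l : ℕ => Bo - (E - W) - 1 - 2 * k + 2 * (l : ℤ)) ⊆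
          F.filter fun r' => r < r' ∧ r' < e₁ := by
        intro r' hr'
        rw [Finset.mem_image] at hr'
        obtain ⟨l, hl, rfl⟩ := hr'
        rw [Finset.mem_range] at hl
        rw [Finset.mem_filter]
        exact ⟨hlinesF l hl, by omega, by omega⟩
      have hcard := Finset.card_le_card hsub
      rw [Finset.card_image_of_injective _ (by intro l l' h; simp only at h; omega), Finset.card_range] at hcard
      omega
  have hwin' := succPerm_pow_window' hz p₁ F H hwinF hdense
  obtain ⟨hd, -⟩ := succPerm_pow_window_inv hz p₁ F H hwinF H le_rfl
  rw [hp₁] at hwin'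
  simp only at hwin'
  set cnt : ℕ := (F.filter fun r => r < e₁).card with hcnt_def
  -- (3) the number of chains crossed: `C₁ + k + q`
  set G₀ := skel (gapSetB N₁ N₂ W E Bo T (u.1, u.2 - H) k) with hG₀_def
  have hG₀mem : ∀ c : ℤ × ℤ, G₀ c = none ↔ c ∈ gapSetB N₁ N₂ W E Bo T (u.1, u.2 - H) k := fun c =>
    skel_eq_none_iff
  have hcnt1 : cnt = noneCount G₀ (E + 1) lo' e₁ := by
    rw [hcnt_def, noneCount]
    congr 1
    ext r
    simp only [hF_def, Finset.mem_filter, Finset.mem_Ioo, Finset.mem_Icc, hG₀mem]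
    constructor
    · rintro ⟨⟨⟨h1, h2⟩, h3⟩, h4⟩
      refine ⟨⟨?_, h4⟩, h3⟩
      have := gapSetB_row_bounds hWE hBT (u' := (u.1, u.2 - H)) (by simp only; omega) h3
      simp only at this
      omega
    · rintro ⟨⟨h1, h2⟩, h3⟩
      have := gapSetB_row_bounds hWE hBT (u' := (u.1, u.2 - H)) (by simp only; omega) h3
      simp only at this
      exact ⟨⟨⟨by omega, by omega⟩, h3⟩, h2⟩
  have hsS₁ : G₀ (E + 1, S₁) ≠ none := by
    rw [Ne, hG₀mem]
    intro h
    rcases mem_gapSetB_mk.mp h with h | h | h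
    · have := boxCompl_row_bounds hWE hBT h; omega
    · have := lines_row_bounds h; simp only at this; omega
    · have := boxCompl_row_bounds hWE hBT h; simp only at this; omega
  have hsS₂ : G₀ (E + 1, S₂) ≠ none := by
    rw [Ne, hG₀mem]
    intro h
    rcases mem_gapSetB_mk.mp h with h | h | h
    · have := boxCompl_row_bounds hWE hBT h; omega
    · have := lines_row_bounds h; simp only at this; omega
    · have := boxCompl_row_bounds hWE hBT h; simp only at this; omega
  have hTq : noneCount G₀ (E + 1) lo' S₁ = q := by
    refine noneCount_congr fun j _ hj2 => ?_
    rw [hG₀mem, hR₃_def, skel_eq_none_iff, mem_shiftSet_mk,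
      mem_gapSetB_z3 hWE hBT (u := (u.1, u.2 - H)) hk (by omega)]
  have hTk : noneCount G₀ (E + 1) S₁ S₂ = k := by
    refine noneCount_eq_of_progression (h₀ := Bo - (E - W) - 1 - 2 * k) (by omega) (by omega)
      fun j hj1 hj2 => ?_
    rw [hG₀mem, mem_gapSetB_z2 hWE hBT (u := (u.1, u.2 - H)) (by simp only; omega) (by omega)]
  have hTC : noneCount G₀ (E + 1) S₂ e₁ = C₁ := by
    refine noneCount_congr fun j hj1 _ => ?_
    rw [hG₀mem, hR₁_def, skel_eq_none_iff, mem_gapSetB_z1 hWE hBT hu' hk (by omega)]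
  have hcnt : (cnt : ℤ) = C₁ + k + q := by
    rw [hcnt1, noneCount_split (a := lo') (b := e₁) (by omega) (by omega) hsS₁,
      noneCount_split (a := S₁) (b := e₁) (by omega) (by omega) hsS₂, hTq, hTk, hTC]
    push_cast
    ring
  -- (4) level from the end of the window to column `t₀`
  set p₁' := (succPerm hz ^ H) p₁ with hp₁'_def
  have hp₁' : p₁'.1 = (E + 1 + H, e₁ - cnt) := hwin'
  have hq₁ : ((succPerm hz ^ s₃) p₁').1 = (t₀, e₁ - cnt) := by
    have hlev := succPerm_pow_level hz p₁' s₃ ?_ s₃ le_rfl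
    · rw [hlev, hp₁']; simp only; rw [hs₃, ht₀_def]; ring
    intro t ht1 ht2 hn
    rw [hp₁'] at ht1 ht2 hn
    simp only at ht1 ht2 hn
    rw [hmemR t _ (by omega)] at hn
    rcases lt_or_ge t (u.1 + W) with ht | ht
    · rw [mem_gapSetB_between hWE (t := t) (by omega) (by simp only; omega), ← hFmem] at hn
      rw [hp₁'] at hd
      simp only at hd
      exact hd hn
    · rcases mem_gapSetB_mk.mp hn with h | h | h
      · rw [mem_boxCompl_of_gt hWE (i := t) (by omega)] at h
        have := rowsE_bounds hWE hBT h
        omega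
      · have := lines_row_bounds h
        simp only at this
        omega
      · have := boxCompl_row_bounds hWE hBT h
        simp only at this
        omega
  -- (5) the second curve: to column `u.1 + E + 1`, then one level step
  have hp₂ : ((succPerm hz ^ m₁) c₂).1 = (u.1 + E + 1, f₂) := by
    rw [← hf₂]
    refine succPerm_pow_local hR₂ hz c₂R c₂ rfl m₁ (fun t j h1 _ _ h4 => ?_) m₁ le_rfl
    simp only [hc₂R_def] at h1 h4
    rw [hR₂_def, skel_eq_none_iff, mem_shiftSet_mk, hmemR t j (by omega),
      mem_gapSetB_z3 hWE hBT (u := (u.1, u.2 - H)) hk (by omega)]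
    simp only
    rw [show j - ↑H - (u.2 - ↑H) = j - u.2 by ring]
  set p₂ := (succPerm hz ^ m₁) c₂ with hp₂_def
  have hq₂ : ((succPerm hz ^ 1) p₂).1 = (t₀, f₂) := by
    have hlev := succPerm_pow_level hz p₂ 1 ?_ 1 le_rfl
    · rw [hlev, hp₂]; simp only; rw [ht₀_def]; push_cast; ring
    intro t ht1 ht2 hn
    rw [hp₂] at ht1 ht2 hn
    simp only [Nat.cast_one] at ht1 ht2 hn
    have ht : t = u.1 + E + 2 := by omega
    rw [ht, hmemR _ _ (by omega), mem_gapSetB_z3 hWE hBT (u := (u.1, u.2 - H)) hk (by omega)] at hn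
    simp only at hn
    rw [show f₂ - ↑H - (u.2 - ↑H) = f₂ - u.2 by ring,
      mem_boxCompl_of_gt hWE (i := u.1 + E + 2 - u.1) (by omega)] at hn
    have hsome : zk (u.1 + E + 1, f₂) ≠ none := by have := p₂.2; rwa [hp₂] at this
    rw [Ne, hmemR _ _ (by omega), mem_gapSetB_z3 hWE hBT (u := (u.1, u.2 - H)) hk (by omega)] at hsome
    simp only at hsome
    rw [show f₂ - ↑H - (u.2 - ↑H) = f₂ - u.2 by ring,
      mem_boxCompl_of_gt hWE (i := u.1 + E + 1 - u.1) (by omega)] at hsome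
    exact hsome hn
  -- (6) the count in column `t₀`
  set q₁ := (succPerm hz ^ s₃) p₁' with hq₁_def
  set q₂ := (succPerm hz ^ 1) p₂ with hq₂_def
  have hzM₂ : ∀ j : ℤ, j ≤ M₂ → zk (t₀, j) ≠ none := by
    intro j hj hn
    rw [hmemR _ _ (by omega), mem_gapSetB_z3 hWE hBT (u := (u.1, u.2 - H)) hk (by omega)] at hn
    have := boxCompl_row_bounds hWE hBT hn
    simp only at this
    omega
  have hB' : noneCount zk t₀ M₂ f₂ = B := by
    refine noneCount_congr fun j _ hj2 => ?_
    rw [hmemR _ _ (by omega), mem_gapSetB_z3 hWE hBT (u := (u.1, u.2 - H)) hk (by omega), hR₂_def,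
      skel_eq_none_iff, mem_shiftSet_mk]
    simp only
    rw [show j - ↑H - (u.2 - ↑H) = j - u.2 by ring]
  obtain ⟨b, hb, hcount⟩ := nxtPerm_pow_eq_of_count hz q₁ q₂ (by rw [hq₁, hq₂]) (by rw [hq₁, hq₂]; simp only; omega)
  rw [hq₁, hq₂] at hcount
  simp only at hcount
  rw [noneCount_split (a := e₁ - cnt) (b := f₂) (by omega) (by omega) (hzM₂ M₂ le_rfl),
    noneCount_eq_zero (fun j _ hj2 => hzM₂ j hj2.le), hB'] at hcount
  push_cast at hcount
  have hbV : (b : ℤ) = f₂ - e₁ + C₁ + q - B + k := by omega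
  -- (7) rearrange
  have hb' : (nxtPerm hz ^ (b : ℤ)) ((succPerm hz ^ ((s₃ + (H + m₁) : ℕ) : ℤ)) c₁) =
      (succPerm hz ^ ((1 + m₁ : ℕ) : ℤ)) c₂ := by
    rw [zpow_natCast, zpow_natCast, zpow_natCast, pow_add, pow_add, pow_add, Equiv.Perm.mul_apply,
      Equiv.Perm.mul_apply, Equiv.Perm.mul_apply]
    exact hb
  have := succ_nxt_rearrange hz c₁ c₂ _ _ _ hb'
  rwa [show ((s₃ + (H + m₁) : ℕ) : ℤ) - ((1 + m₁ : ℕ) : ℤ) = u.1 by push_cast; omega, hbV,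
    show f₂ - e₁ + ↑C₁ + ↑q - ↑B + (k : ℤ) = f₂ - e₁ + C₁ + q - B + k from rfl] at this

end LevelMain

end Literature.Dynamics.SymbolicDynamics.Distortion
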